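import Summits.QuantumFields.BalabanUV.Beta.GAN24.MonotoneCompose

/-!
# `BalabanUV.Beta.GAN24.AliasNest` — binder row G-an2-4 / (CONV-C), S-slot remainder «E3Shape»: NESTED ALIAS FRAMES (the momentum-side
# twin of `GAN24/PushSumNest`), node S3-L3(c) of `HOME/b2b-balaban-gan24-p1/SKELETON-S3.md` v0.3 (I-L3 sub-leaf «`pushSum_symbol` = geometric-sum
# map between the alias frames of levels M and M·Lc»; typer DAG § II.6 prospective R6 «push∕avgLift maps between NESTED alias frames»; R-S3-3)

NOT IN PRINT; OUR PROOF ATTEMPT.  HONEST FRAMING (cell contract, verbatim): «discharging `BetaPertH` makes Bałaban's UV stability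
UNCONDITIONAL — a real constructive-QFT result; it is NOT the continuum limit and NOT the Clay problem.»  HONEST DEPENDENCY (verbatim):
«continuum YM on T⁴ ⇐ BetaPertH ∧ nine spine estimates (0/9 proved); BetaPertH ⇐ (D1) ∧ (D4) ∧ CAP+tail; G-an2-4 gates asym, D1 and
NE2/3/4.»  [folklore] finite combinatorics of `(ℤ/N)^D` (Mathlib `ZMod.val`) and the `2π`-periodicity ∕ scale factorisation of geometric sums
over the swarm's binding currency T00 `GAN24/AliasObjects` (`kAl gs sAl SAl sbAl SbAl chiAl wAl dAl dbAl LAl sMAl SMAl sbMAl SbMAl readW srcW`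
BY NAME), `GAN24/AliasReindex.gs_add_two_pi_mul` and road P4's `GAN24/MonotoneCompose.gs_mul` BY NAME — nothing redefined; NO estimate, NO cited
fact, NO `def … : Prop` hypothesis, NO wall binder.  Register engine E8 «ALIAS-NEST*» of unit `b2b-balaban-gan24-formalise-leaf-17`
(written gen 9, journal RESULT-2 l.4238; typer `GAN24/Formal/LEAVES.md` § II.D E8: «T-E1 class … file-worthy as `GAN24/AliasNest`»; filed gen 11 as the
index dictionary of the lineage chain `PushSumNest` → `AliasTiling`∕`AliasDecimate` → `PushSumSymbol`∕`MinimiserColumnDecimate`: the alias indices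
of two nested blockings, `(ℤ∕(L·Nm))^D ≃ (ℤ∕L)^D × (ℤ∕Nm)^D`, for any two-level alias-frame comparison such as «(N1-Cauchy)» of
`SKELETON-S3.md` §13.2); the reserved family `GAN24.StencilSlotE3*` is untouched.  NOT summit progress; nothing of (CONV-C)'s S-slot is discharged here.

## What is proved (generic `D`; three block sides `N = L·Nm`, all `≠ 0`; COMPLEX coarse momentum `P`)
Two alias frames are in play when a level-`Nm` object (fine lattice blocked by `Nm`) is pushed through `L` more blockings to level
`N = L·Nm` (`GAN24/PushSumNest.Sc_succ_closed`: the level-`m` increment is pushed by ONE `pushSum (Lc^{m+2}) (Lc^{n−m})`): the level-`N`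
frame (coarse momentum `P`, aliases `m ∈ (ℤ/N)^D`, fine momenta `kAl N P m`) and the level-`Nm` frame at each of the `L^D` intermediate
coarse momenta `q_l = kAl L P l`, `l ∈ (ℤ/L)^D` (aliases `m′ ∈ (ℤ/Nm)^D`, fine momenta `kAl Nm q_l m′`).  They NEST:
* §1 `nest N L l m′ ∈ (ℤ/N)^D`, `val (nest … i) = val (l i) + L·val (m′ i)` (`val_nest`), with inverse `unnestL ∕ unnestM` (coordinatewise
  remainder ∕ quotient by `L`), packaged as **`nestEquiv : (ℤ/L)^D × (ℤ/Nm)^D ≃ (ℤ/N)^D`**; `sum_nest : Σ_{m} F m = Σ_l Σ_{m′} F (nest N L l m′)`.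
* §2 **`kAl_nest : kAl N P (nest N L l m′) = kAl Nm (kAl L P l) m′`** — the SAME fine momentum in the two frames — and the folding identity
  `Nm · kAl N P (nest N L l m′) i = kAl L P l i + 2π·val (m′ i)` (`natCast_mul_kAl_nest`); hence every per-alias symbol of T00 that is a
  function of the fine momentum reads through: `dAl_nest`, `dbAl_nest`, `LAl_nest`, `sMAl_nest`, `sbMAl_nest`, `SMAl_nest`, `SbMAl_nest`,
  `readW_nest`, `srcW_nest` (the last with the explicit factor `L^{−D}` from its `N^{−D}`).
* §3 THE BOX WEIGHTS FACTORISE THROUGH THE NESTING (Bałaban's `Q_{L·Nm} = Q_L ∘ Q_{Nm}` [Balaban1984PropagatorsI (1.16)–(1.17)] in the alias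
  frame, via `MonotoneCompose.gs_mul` + `AliasReindex.gs_add_two_pi_mul`): **`sAl_nest : sAl N P (nest N L l m′) κ = sAl Nm (kAl L P l) m′ κ · sAl L P l κ`**,
  `sbAl_nest`, `SAl_nest`, `SbAl_nest`, `chiAl_nest` (`χ_N = χ_{Nm} · χ_L`), `wAl_nest`.
No analysis.  Prospective consumers: the alias-frame symbol of ONE push `pushSum M L` (I-L3 `pushSum_symbol`: outer weight `sAl L`-type
contour factors at the intermediate momenta `q_l`, inner objects re-indexed by `nest`), S3-L4's level sum, S3-L8 ∕ «E3SupRate».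
-/

noncomputable section

open Complex Finset
open scoped BigOperators Real
open Literature.Probability.LatticeModels (TorusSite)
open Literature.MathematicalPhysics.QuantumFieldTheory
open Literature.MathematicalPhysics.QuantumFieldTheory.LatticeForm (repZ)
open Summit.QuantumFields.BalabanUV.Beta.GAN24.AliasObjects
  (kAl kAl_apply gs sAl SAl sbAl SbAl chiAl wAl dAl dbAl LAl sMAl SMAl sbMAl SbMAl readW srcW)
open Summit.QuantumFields.BalabanUV.Beta.GAN24.AliasReindex (gs_add_two_pi_mul gs_neg_add_two_pi_mul)
open Summit.QuantumFields.BalabanUV.Beta.GAN24.MonotoneCompose (gs_mul)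

namespace Summit.QuantumFields.BalabanUV.Beta.GAN24.AliasNest

variable {D : ℕ} {N L Nm : ℕ}

/-! ## §1 The nesting map `(ℤ/L)^D × (ℤ/Nm)^D → (ℤ/N)^D`, `N = L·Nm` -/

section Nest

/-- [folklore] THE NESTED ALIAS CLASS: the level-`N` alias index of (intermediate coarse alias `l`, level-`Nm` fine alias `m′`) is
`m = l + L·m′` coordinatewise (`N = L·Nm`). -/
def nest (N L : ℕ) (l : TorusSite D L) (m' : TorusSite D Nm) : TorusSite D N :=
  fun i => (((l i).val + L * (m' i).val : ℕ) : ZMod N)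

/-- [folklore] `val l + L·val m′ < L·Nm`. -/
theorem val_add_mul_val_lt [NeZero L] [NeZero Nm] (l : TorusSite D L) (m' : TorusSite D Nm) (i : Fin D) :
    (l i).val + L * (m' i).val < L * Nm := by
  have hl : (l i).val < L := ZMod.val_lt _
  have hm : (m' i).val + 1 ≤ Nm := ZMod.val_lt _
  calc (l i).val + L * (m' i).val < L + L * (m' i).val := Nat.add_lt_add_right hl _
    _ = L * ((m' i).val + 1) := by ring
    _ ≤ L * Nm := Nat.mul_le_mul_left _ hm

/-- [folklore] **The representative of the nested class**: `val (nest N L l m′ i) = val (l i) + L·val (m′ i)`. -/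
theorem val_nest [NeZero L] [NeZero Nm] (hN : N = L * Nm) (l : TorusSite D L) (m' : TorusSite D Nm) (i : Fin D) :
    (nest N L l m' i).val = (l i).val + L * (m' i).val := by
  rw [nest, ZMod.val_natCast, Nat.mod_eq_of_lt (hN ▸ val_add_mul_val_lt l m' i)]

/-- [folklore] The same for the integer representative `repZ` of `GAN24/AliasObjects`/`FibreDFT`. -/
theorem repZ_nest [NeZero L] [NeZero Nm] (hN : N = L * Nm) (l : TorusSite D L) (m' : TorusSite D Nm) (i : Fin D) :
    repZ (nest N L l m') i = repZ l i + (L : ℤ) * repZ m' i := by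
  simp only [repZ, val_nest hN]
  push_cast
  ring

/-- [folklore] Inverse, coarse part: the remainder of the representative modulo `L`. -/
def unnestL (L : ℕ) (m : TorusSite D N) : TorusSite D L := fun i => (((m i).val % L : ℕ) : ZMod L)

/-- [folklore] Inverse, fine part: the quotient of the representative by `L`. -/
def unnestM (L Nm : ℕ) (m : TorusSite D N) : TorusSite D Nm := fun i => (((m i).val / L : ℕ) : ZMod Nm)

/-- [folklore] `unnestL ∘ nest = fst`. -/
theorem unnestL_nest [NeZero L] [NeZero Nm] (hN : N = L * Nm) (l : TorusSite D L) (m' : TorusSite D Nm) :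
    unnestL L (nest N L l m') = l := by
  funext i
  rw [unnestL, val_nest hN, Nat.add_mul_mod_self_left, Nat.mod_eq_of_lt (ZMod.val_lt _), ZMod.natCast_zmod_val]

/-- [folklore] `unnestM ∘ nest = snd`. -/
theorem unnestM_nest [NeZero L] [NeZero Nm] (hN : N = L * Nm) (l : TorusSite D L) (m' : TorusSite D Nm) :
    unnestM L Nm (nest N L l m') = m' := by
  funext i
  have hL : 0 < L := Nat.pos_of_ne_zero (NeZero.ne L)
  rw [unnestM, val_nest hN, Nat.add_mul_div_left _ _ hL, Nat.div_eq_of_lt (ZMod.val_lt _), zero_add, ZMod.natCast_zmod_val]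

/-- [folklore] `nest ∘ (unnestL, unnestM) = id`. -/
theorem nest_unnest [NeZero L] [NeZero Nm] [NeZero N] (hN : N = L * Nm) (m : TorusSite D N) :
    nest N L (unnestL L m) (unnestM L Nm m) = m := by
  funext i
  have hdiv : (m i).val / L < Nm := Nat.div_lt_of_lt_mul (hN ▸ ZMod.val_lt (m i))
  rw [nest, unnestL, unnestM, ZMod.val_natCast, ZMod.val_natCast, Nat.mod_mod, Nat.mod_eq_of_lt hdiv, Nat.mod_add_div,
    ZMod.natCast_zmod_val]

/-- [folklore] **THE NESTING EQUIVALENCE** `(ℤ/L)^D × (ℤ/Nm)^D ≃ (ℤ/N)^D` (`N = L·Nm`). -/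
def nestEquiv [NeZero L] [NeZero Nm] [NeZero N] (hN : N = L * Nm) : TorusSite D L × TorusSite D Nm ≃ TorusSite D N where
  toFun x := nest N L x.1 x.2
  invFun m := (unnestL L m, unnestM L Nm m)
  left_inv x := Prod.ext (unnestL_nest hN x.1 x.2) (unnestM_nest hN x.1 x.2)
  right_inv m := nest_unnest hN m

/-- [folklore] Unfolding of the equivalence. -/
theorem nestEquiv_apply [NeZero L] [NeZero Nm] [NeZero N] (hN : N = L * Nm) (x : TorusSite D L × TorusSite D Nm) :
    nestEquiv hN x = nest N L x.1 x.2 := rfl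

/-- [folklore] The nesting map is injective in the pair. -/
theorem nest_injective [NeZero L] [NeZero Nm] [NeZero N] (hN : N = L * Nm) :
    Function.Injective (fun x : TorusSite D L × TorusSite D Nm => nest N L x.1 x.2) :=
  (nestEquiv (D := D) hN).injective

/-- [folklore] **RE-INDEXING OF ALIAS SUMS ACROSS NESTED FRAMES**: a sum over the level-`N` aliases is the double sum over the
intermediate coarse aliases `l` and the level-`Nm` aliases `m′`. -/
theorem sum_nest {E : Type*} [AddCommMonoid E] [NeZero L] [NeZero Nm] [NeZero N] (hN : N = L * Nm) (F : TorusSite D N → E) :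
    ∑ m, F m = ∑ l : TorusSite D L, ∑ m' : TorusSite D Nm, F (nest N L l m') := by
  rw [← Fintype.sum_prod_type']
  exact (Fintype.sum_equiv (nestEquiv hN) _ _ fun x => rfl).symm

end Nest

/-! ## §2 The same fine momentum in the two frames -/

section Momentum

variable [NeZero L] [NeZero Nm] [NeZero N]

/-- [folklore] **NESTED FRAMES SHARE THE FINE MOMENTUM**: `kAl N P (nest N L l m′) = kAl Nm (kAl L P l) m′` — the fine momentum of the
level-`N` alias `l + L·m′` above `P` is the fine momentum of the level-`Nm` alias `m′` above the intermediate coarse momentum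
`q_l = kAl L P l = (P + 2π l)/L`. -/
theorem kAl_nest (hN : N = L * Nm) (P : Fin D → ℂ) (l : TorusSite D L) (m' : TorusSite D Nm) :
    kAl N P (nest N L l m') = kAl Nm (kAl L P l) m' := by
  funext i
  have hL : (L : ℂ) ≠ 0 := by exact_mod_cast NeZero.ne L
  have hNm : (Nm : ℂ) ≠ 0 := by exact_mod_cast NeZero.ne Nm
  rw [kAl_apply, kAl_apply, kAl_apply, repZ_nest hN, hN]
  push_cast
  field_simp
  ring

/-- [folklore] THE FOLDING IDENTITY: `Nm · kAl N P (nest N L l m′) i = kAl L P l i + 2π·val (m′ i)` — the intermediate coarse momentum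
read off the fine one, modulo `2π` (the input of `AliasReindex.gs_add_two_pi_mul` / `MonotoneCompose.gs_mul_periodic`). -/
theorem natCast_mul_kAl_nest (hN : N = L * Nm) (P : Fin D → ℂ) (l : TorusSite D L) (m' : TorusSite D Nm) (i : Fin D) :
    (Nm : ℂ) * kAl N P (nest N L l m') i = kAl L P l i + 2 * π * (((m' i).val : ℤ) : ℂ) := by
  have hNm : (Nm : ℂ) ≠ 0 := by exact_mod_cast NeZero.ne Nm
  rw [kAl_nest hN, kAl_apply, mul_div_cancel₀ _ hNm]
  simp only [repZ]

/-- [folklore] `dAl` reads through the nesting. -/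
theorem dAl_nest (hN : N = L * Nm) (P : Fin D → ℂ) (l : TorusSite D L) (m' : TorusSite D Nm) :
    dAl N P (nest N L l m') = dAl Nm (kAl L P l) m' := by
  simp only [dAl, kAl_nest hN]

/-- [folklore] `dbAl` reads through the nesting. -/
theorem dbAl_nest (hN : N = L * Nm) (P : Fin D → ℂ) (l : TorusSite D L) (m' : TorusSite D Nm) :
    dbAl N P (nest N L l m') = dbAl Nm (kAl L P l) m' := by
  simp only [dbAl, kAl_nest hN]

/-- [folklore] `LAl` reads through the nesting. -/
theorem LAl_nest (hN : N = L * Nm) (P : Fin D → ℂ) (l : TorusSite D L) (m' : TorusSite D Nm) :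
    LAl N P (nest N L l m') = LAl Nm (kAl L P l) m' := by
  simp only [LAl, kAl_nest hN]

/-- [folklore] Sub-block weights (any sub-block side `M`) read through the nesting. -/
theorem sMAl_nest (hN : N = L * Nm) (M : ℕ) (P : Fin D → ℂ) (l : TorusSite D L) (m' : TorusSite D Nm) (κ : Fin D) :
    sMAl N M P (nest N L l m') κ = sMAl Nm M (kAl L P l) m' κ := by
  simp only [sMAl, kAl_nest hN]

/-- [folklore] Flat sub-block weights read through the nesting. -/
theorem sbMAl_nest (hN : N = L * Nm) (M : ℕ) (P : Fin D → ℂ) (l : TorusSite D L) (m' : TorusSite D Nm) (κ : Fin D) :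
    sbMAl N M P (nest N L l m') κ = sbMAl Nm M (kAl L P l) m' κ := by
  simp only [sbMAl, kAl_nest hN]

/-- [folklore] Sub-block box products read through the nesting. -/
theorem SMAl_nest (hN : N = L * Nm) (M : ℕ) (P : Fin D → ℂ) (l : TorusSite D L) (m' : TorusSite D Nm) :
    SMAl N M P (nest N L l m') = SMAl Nm M (kAl L P l) m' := by
  simp only [SMAl, sMAl_nest hN]

/-- [folklore] Flat sub-block box products read through the nesting. -/
theorem SbMAl_nest (hN : N = L * Nm) (M : ℕ) (P : Fin D → ℂ) (l : TorusSite D L) (m' : TorusSite D Nm) :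
    SbMAl N M P (nest N L l m') = SbMAl Nm M (kAl L P l) m' := by
  simp only [SbMAl, sbMAl_nest hN]

/-- [folklore] The sub-block of side `Nm` inside level `N` IS the block of level `Nm`: `sMAl N Nm P (nest …) κ = sAl Nm q_l m′ κ`. -/
theorem sMAl_nest_self (hN : N = L * Nm) (P : Fin D → ℂ) (l : TorusSite D L) (m' : TorusSite D Nm) (κ : Fin D) :
    sMAl N Nm P (nest N L l m') κ = sAl Nm (kAl L P l) m' κ := by
  rw [sMAl_nest hN]; rfl

/-- [folklore] … and the box product: `SMAl N Nm P (nest …) = SAl Nm q_l m′`. -/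
theorem SMAl_nest_self (hN : N = L * Nm) (P : Fin D → ℂ) (l : TorusSite D L) (m' : TorusSite D Nm) :
    SMAl N Nm P (nest N L l m') = SAl Nm (kAl L P l) m' := by
  rw [SMAl_nest hN]; rfl

/-- [folklore] The `M`-level READING WEIGHT reads through the nesting (it depends on the level only through the fine momentum). -/
theorem readW_nest (hN : N = L * Nm) (M : ℕ) (P : Fin D → ℂ) (l : TorusSite D L) (m' : TorusSite D Nm) (κ : Fin D) (ρ : Fin D → ℤ) :
    readW N M P (nest N L l m') κ ρ = readW Nm M (kAl L P l) m' κ ρ := by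
  simp only [readW, kAl_nest hN, SMAl_nest hN, sMAl_nest hN]

/-- [folklore] The `M`-level SOURCE WEIGHT reads through the nesting up to the box-DFT normalisation `N^{−D} = Nm^{−D}·L^{−D}`. -/
theorem srcW_nest (hN : N = L * Nm) (M : ℕ) (P : Fin D → ℂ) (l : TorusSite D L) (m' : TorusSite D Nm) (κ : Fin D) (ρ : Fin D → ℤ) :
    srcW N M P (nest N L l m') κ ρ = srcW Nm M (kAl L P l) m' κ ρ / (L : ℂ) ^ D := by
  simp only [srcW, kAl_nest hN, SbMAl_nest hN, sbMAl_nest hN, div_div]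
  congr 1
  rw [hN]
  push_cast
  ring

end Momentum

/-! ## §3 The box weights factorise through the nesting: `Q_{L·Nm} = Q_L ∘ Q_{Nm}` in the alias frame -/

section Weights

variable [NeZero L] [NeZero Nm] [NeZero N]

/-- [folklore] **DIRECTIONAL BOX WEIGHT**: `s_{N,κ}(l + L·m′; P) = s_{Nm,κ}(m′; q_l) · s_{L,κ}(l; P)` — a run of `N = Nm·L` fine phases is `L`
runs of `Nm` (`MonotoneCompose.gs_mul`), the outer run read at the folded momentum `Nm·k ≡ q_l (mod 2π)` (`AliasReindex.gs_add_two_pi_mul`). -/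
theorem sAl_nest (hN : N = L * Nm) (P : Fin D → ℂ) (l : TorusSite D L) (m' : TorusSite D Nm) (κ : Fin D) :
    sAl N P (nest N L l m') κ = sAl Nm (kAl L P l) m' κ * sAl L P l κ := by
  have e : N = Nm * L := by rw [hN, Nat.mul_comm]
  show gs (kAl N P (nest N L l m') κ) N = gs (kAl Nm (kAl L P l) m' κ) Nm * gs (kAl L P l κ) L
  rw [congrArg (gs (kAl N P (nest N L l m') κ)) e, gs_mul, natCast_mul_kAl_nest hN, gs_add_two_pi_mul, kAl_nest hN]

/-- [folklore] FLAT directional box weight: `s♭_{N,κ}(l + L·m′; P) = s♭_{Nm,κ}(m′; q_l) · s♭_{L,κ}(l; P)`. -/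
theorem sbAl_nest (hN : N = L * Nm) (P : Fin D → ℂ) (l : TorusSite D L) (m' : TorusSite D Nm) (κ : Fin D) :
    sbAl N P (nest N L l m') κ = sbAl Nm (kAl L P l) m' κ * sbAl L P l κ := by
  have e : N = Nm * L := by rw [hN, Nat.mul_comm]
  show gs (-kAl N P (nest N L l m') κ) N = gs (-kAl Nm (kAl L P l) m' κ) Nm * gs (-kAl L P l κ) L
  rw [congrArg (gs (-kAl N P (nest N L l m') κ)) e, gs_mul, mul_neg, natCast_mul_kAl_nest hN, gs_neg_add_two_pi_mul, kAl_nest hN]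

/-- [folklore] **BOX WEIGHT**: `S_N(l + L·m′; P) = S_{Nm}(m′; q_l) · S_L(l; P)`. -/
theorem SAl_nest (hN : N = L * Nm) (P : Fin D → ℂ) (l : TorusSite D L) (m' : TorusSite D Nm) :
    SAl N P (nest N L l m') = SAl Nm (kAl L P l) m' * SAl L P l := by
  simp only [SAl, sAl_nest hN, Finset.prod_mul_distrib]

/-- [folklore] FLAT box weight: `S♭_N(l + L·m′; P) = S♭_{Nm}(m′; q_l) · S♭_L(l; P)`. -/
theorem SbAl_nest (hN : N = L * Nm) (P : Fin D → ℂ) (l : TorusSite D L) (m' : TorusSite D Nm) :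
    SbAl N P (nest N L l m') = SbAl Nm (kAl L P l) m' * SbAl L P l := by
  simp only [SbAl, sbAl_nest hN, Finset.prod_mul_distrib]

/-- [folklore] **THE NORMALISED AVERAGING SYMBOL NESTS**: `χ_N(l + L·m′; P) = χ_{Nm}(m′; q_l) · χ_L(l; P)` — Bałaban's composition of
averagings `Q_{L·Nm} = Q_L ∘ Q_{Nm}` in the alias frame. -/
theorem chiAl_nest (hN : N = L * Nm) (P : Fin D → ℂ) (l : TorusSite D L) (m' : TorusSite D Nm) :
    chiAl N P (nest N L l m') = chiAl Nm (kAl L P l) m' * chiAl L P l := by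
  have hL : (L : ℂ) ≠ 0 := by exact_mod_cast NeZero.ne L
  have hNm : (Nm : ℂ) ≠ 0 := by exact_mod_cast NeZero.ne Nm
  simp only [chiAl, SbAl_nest hN, hN, Nat.cast_mul, mul_pow]
  field_simp

/-- [folklore] The weight `w = S·χ` nests. -/
theorem wAl_nest (hN : N = L * Nm) (P : Fin D → ℂ) (l : TorusSite D L) (m' : TorusSite D Nm) :
    wAl N P (nest N L l m') = wAl Nm (kAl L P l) m' * wAl L P l := by
  simp only [wAl, SAl_nest hN, chiAl_nest hN]
  ring

end Weights

end Summit.QuantumFields.BalabanUV.Beta.GAN24.AliasNest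

end
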